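/-
Copyright (c) 2026 the pub-hodgecm-mathlib formalisation cell (harness21).  Prover seat hodgecm-mathlib-F0P3a-p01 (g23), 2026-09-03.  E1 row 39γ «EVERY GEODESIC SEGMENT OF THE
UNRAMIFIED `U(3)` TREE LIES IN A TRANSLATE OF THE STANDARD APARTMENT» — file γ of the (U7) census v0 (LH6-p04 (g11)) §1 (L6) ∕ §4; E1 keeper ∕ dealer F0P3a-p03 (g29) 01:32:15Z.
-/
import Literature.NumberTheory.Automorphic.UnitaryLatticeTreeTypeTwoTransitive   -- ★ `isTree_latticeGraph_three_of_unramified`, `forall_isVertexLattice_two_exists_mapGL_N₁_eq`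
import Literature.NumberTheory.Automorphic.UnitaryLatticeTreeApartmentPath       -- ★ `latticeGraph_adj_apartment_two_selfDual`, `…_selfDual_two_succ`, `v_zpow_le_v_zpow_iff`, `latt_diagonal_le_latt_diagonal_iff`
import Literature.NumberTheory.Automorphic.UnitaryLatticeTreeSelfDualFrames      -- ★ `exists_frame_three_of_isSelfDualLattice`, `latt_diagonal_congr`
import Literature.NumberTheory.Automorphic.UnitaryLatticeTreeTypeTwoNormalForm   -- ★ `weylLongU_mem_unitaryInt`, `mapGL_weylLongU_latt_diagonal_mul`, `mapGL_latt_eq`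
import Literature.NumberTheory.Automorphic.UnitaryLatticeTreeParent              -- ★ `latt_mul_antidiagonal`
import Literature.NumberTheory.Automorphic.UnitaryLatticeTreeApartmentAction     -- ★ `v_le_one_of_v_eq_exp_neg_one` (brings ★ ApartmentTorus ∕ Apartment: `exists_coe_eq_diagonal_zpow`, `mapGL_coe_latt_eq`, `mapGL_stdLattice_of_mem_unitaryInt`)
import Literature.Combinatorics.SimpleGraph.TreeDescendantPartition               -- ★ `TreeLayers.dist_iso_apply` (graph distance is invariant under `≃g`)
import Literature.Combinatorics.SimpleGraph.TreeSequenceGeodesic                  -- (this seat, E1 row 39γ generic half) `SequencePath.dist_eq_natAbs`, `…exists_eq_of_dist_add_dist_eq`, `…exists_dist_eq_succ_of_adj_of_adj`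
import HarnessLib

/-!
# The lattice tree of the unramified `U(3)`: EVERY GEODESIC SEGMENT LIES IN A TRANSLATE OF THE STANDARD APARTMENT (Bruhat–Tits 1972 (7.4.18), §10; Serre, *Trees* I.2.2, II.1.1)

Topic `NumberTheory/Automorphic`; namespace `Literature.NumberTheory.Automorphic.UnitaryLatticeTree` (T1a currency of ★ `UnitaryLatticeTreeDefs`); the generic tree
combinatorics is ★ `Combinatorics/SimpleGraph/TreeSequenceGeodesic` (`SequencePath.*`).  THEOREMS ONLY (no definition, no instance, no notation, no named fact, no `sorry`).
Cell `pub/hodgecm-mathlib` (D-0151), crux H413 = `stmt-HodgeConjecture-24833`; E1 row 39γ = file γ of the (U7) census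
`F0/P3b/LH6-p04/g11/u7/CENSUS-U7-geodesic-inclusion.v0.LH6p04g11.md` §1 (L6): the geometric half of Schneider–Stuhler's geodesic inclusion (U7)
`U_y^{(e)} ⊆ U_x^{(e)} · U_z^{(e)}` — before one can factorise along an apartment (files α∕β), the three vertices must be PUT into one apartment.
HONEST LABEL: count-neutral lattice-model base layer ((R-SS) engine not chartered); HC_CM is proved only modulo the 2 remaining named inputs (hLiu418 24832, h413 24833)
until rung 0 closes; nothing printed is asserted here — tree combinatorics + the ★ Cartan∕frame∕type-two transitivity of the unramified `U(3)` kit.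

THE STANDARD APARTMENT, ENUMERATED.  `J₀ = antidiag(1,1,1)`, `hd : UnramifiedLocalConjDatum σ ϖ`.  The apartment of the diagonal torus is the bi-infinite path
`… — L′_a — L_a — L′_{a+1} — L_{a+1} — …` (★ `UnitaryLatticeTreeApartmentPath`), `L_a = latt diag(ϖ^a, 1, ϖ^{−a})` (self-dual), `L′_a = latt diag(ϖ^a, 1, ϖ^{1−a})` (type 2).
We index it by ONE integer: `A(2a) = L_a`, `A(2a+1) = L′_{a+1} = latt diag(ϖ^{a+1}, 1, ϖ^{−a})` (exponent vectors `(a, 0, −a)`, `(a+1, 0, −a)`: census §1).  No definition is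
made: the enumeration is HYPOTHESIS-STYLE, `(A : ℤ → {M // IsVertex σ ϖ J₀ M}) (hA0 : ∀ a, (A (2a)).1 = L_a) (hA1 : ∀ a, (A (2a+1)).1 = latt diag(ϖ^{a+1}, 1, ϖ^{−a}))`,
and §1 `exists_apartmentEnum` supplies it.

* §1 the enumeration: `exists_apartmentEnum`; `latticeGraph_adj_apartmentEnum_succ` (`A j ~ A (j+1)`); `latt_diagonal_zpow_one_zpow_eq_iff`; `apartmentEnum_injective`;
  **`dist_apartmentEnum`** (`dist (A i) (A k) = |k − i|`); `exists_eq_apartmentEnum_of_dist_add_dist_eq`; `mapGL_weylLongU_apartmentEnum` (`w₀ · A j = A (−j)`); `coe_apartmentEnum_zero`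
  (`A 0 = 𝒪³`); transport by `u ∈ U(σ, J₀)`: `dist_latticeGraphIso_apartmentEnum`, `exists_eq_latticeGraphIso_apartmentEnum_of_dist_add_dist_eq`.
* §2 TWO VERTICES LIE IN ONE APARTMENT TRANSLATE: `exists_latticeGraphIso_apartmentEnum_of_isSelfDualLattice₂` (two self-dual vertices: `(x, z) = u·(A 0, A (2b))`, `0 ≤ b`; ★ frames
  + ★ `w₀`); `exists_eq_latticeGraphIso_apartmentEnum_neg_one` (a type-two vertex is `v·A (−1)`); `exists_latticeGraphIso_apartmentEnum_of_isSelfDualLattice` (self-dual `x`, any `z`: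
  a type-two `z` is pushed to an OUTWARD self-dual neighbour); **`exists_latticeGraphIso_apartmentEnum_pair`** (ANY `x, z`: `x = u·A i`, `z = u·A k`, `i ≤ k`);
  **`exists_latticeGraphIso_apartmentEnum_geodesic`** (moreover `dist x z = k − i` and every `w` on `[x, z]` is `u·A j`, `i ≤ j ≤ k`); the (U7) consumer shape
  **`exists_latticeGraphIso_apartmentEnum_of_adj_of_dist`** (`x ~ y`, `dist y z + 1 = dist x z` ⇒ `(x, y, z) = u·(A i, A (i+1), A k)`, `i + 1 ≤ k` — ★ row 34's `hU7` antecedent).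

## References
* [BruhatTits1972] F. Bruhat, J. Tits, *Groupes réductifs sur un corps local I*, Publ. Math. IHÉS 41 (1972), (7.4.18) (two facets lie in a common apartment), §10 (lattice models).
* [Serre1980Trees] J.-P. Serre, *Trees* (1980), Ch. I §2.2 Prop. 8 (geodesics in a tree are unique), Ch. II §1.1 (the tree of `SL₂`: the straight path of diagonal lattices).
* [SchneiderStuhler1997] P. Schneider, U. Stuhler, *Representation theory and sheaves on the Bruhat–Tits building*, Publ. Math. IHÉS 85 (1997), Ch. I Prop. I.3.1 p. 118 (U7).
* [Diestel2010] R. Diestel, *Graph Theory*, 4th ed. (2010), Thm. 1.5.1 (paths in trees).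
-/

set_option autoImplicit false

open scoped Valued WithZero Matrix MatrixGroups

/-! ## §1 The standard apartment of `U(3)`, enumerated by one integer: `A(2a) = L_a`, `A(2a+1) = L′_{a+1}` -/

namespace Literature.NumberTheory.Automorphic.UnitaryLatticeTree

open _root_.SimpleGraph Literature.NumberTheory.Automorphic Literature.NumberTheory.Automorphic.HermitianLattice
open Literature.NumberTheory.Automorphic.CartanUnique (uniformizer_ne_zero)
open Literature.Combinatorics.SimpleGraph

variable {K : Type*} [Field K] [Valued K ℤᵐ⁰] {σ : K →+* K} {ϖ : K}

/-- **THE ENUMERATED APARTMENT EXISTS**: there is `A : ℤ → {vertices}` with `A(2a) = L_a = latt diag(ϖ^a, 1, ϖ^{−a})` and `A(2a+1) = L′_{a+1} = latt diag(ϖ^{a+1}, 1, ϖ^{−a})`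
(take `A j := latt diag(ϖ^{⌈j∕2⌉}, 1, ϖ^{−⌊j∕2⌋})`, a vertex by ★ `isSelfDualLattice_latt_diagonal_zpow` ∕ ★ `isVertexLattice_two_latt_diagonal_zpow`). [cite: BruhatTits1972, §10]
[cite: Serre1980Trees, II.1.1] -/
theorem exists_apartmentEnum (hd : UnramifiedLocalConjDatum σ ϖ) :
    ∃ A : ℤ → {M : Submodule 𝒪[K] (Fin 3 → K) // IsVertex σ ϖ ((StdForm.antidiagonal 3).over K) M},
      (∀ a : ℤ, (A (2 * a)).1 = latt (Matrix.diagonal ![ϖ ^ a, (1 : K), ϖ ^ (-a)])) ∧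
      (∀ a : ℤ, (A (2 * a + 1)).1 = latt (Matrix.diagonal ![ϖ ^ (a + 1), (1 : K), ϖ ^ (-a)])) := by
  have hϖ1 : Valued.v ϖ ≤ 1 := v_le_one_of_v_eq_exp_neg_one hd.vϖ
  have hϖ0 : ϖ ≠ 0 := uniformizer_ne_zero hd.vϖ
  have hV : ∀ j : ℤ, IsVertex σ ϖ ((StdForm.antidiagonal 3).over K) (latt (Matrix.diagonal ![ϖ ^ ((j + 1) / 2), (1 : K), ϖ ^ (-(j / 2))])) := by
    intro j
    rcases Int.emod_two_eq_zero_or_one j with h | h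
    · have hj : (j + 1) / 2 = j / 2 := by omega
      rw [hj]
      exact ⟨0, isSelfDualLattice_latt_diagonal_zpow hd.σσ hd.σϖ hϖ1 hϖ0 (j / 2)⟩
    · have hj : (j + 1) / 2 = j / 2 + 1 := by omega
      have hj' : (-(j / 2) : ℤ) = 1 - (j / 2 + 1) := by ring
      rw [hj, hj']
      exact ⟨2, isVertexLattice_two_latt_diagonal_zpow hd.σσ hd.σϖ hϖ1 hϖ0 (j / 2 + 1)⟩
  refine ⟨fun j => ⟨_, hV j⟩, fun a => ?_, fun a => ?_⟩
  · show latt (Matrix.diagonal ![ϖ ^ ((2 * a + 1) / 2), (1 : K), ϖ ^ (-(2 * a / 2))]) = _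
    have h1 : (2 * a + 1) / 2 = a := by omega
    have h2 : 2 * a / 2 = a := by omega
    rw [h1, h2]
  · show latt (Matrix.diagonal ![ϖ ^ ((2 * a + 1 + 1) / 2), (1 : K), ϖ ^ (-((2 * a + 1) / 2))]) = _
    have h1 : (2 * a + 1 + 1) / 2 = a + 1 := by omega
    have h2 : (2 * a + 1) / 2 = a := by omega
    rw [h1, h2]

section Enum

variable (hd : UnramifiedLocalConjDatum σ ϖ)
  (A : ℤ → {M : Submodule 𝒪[K] (Fin 3 → K) // IsVertex σ ϖ ((StdForm.antidiagonal 3).over K) M})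
  (hA0 : ∀ a : ℤ, (A (2 * a)).1 = latt (Matrix.diagonal ![ϖ ^ a, (1 : K), ϖ ^ (-a)]))
  (hA1 : ∀ a : ℤ, (A (2 * a + 1)).1 = latt (Matrix.diagonal ![ϖ ^ (a + 1), (1 : K), ϖ ^ (-a)]))
include hd hA0 hA1

/-- **Consecutive apartment vertices are adjacent: `A j ~ A (j+1)`** (★ `L_a — L′_{a+1}` and ★ `L′_{a+1} — L_{a+1}`). [cite: BruhatTits1972, §10] [cite: Serre1980Trees, II.1.1] -/
theorem latticeGraph_adj_apartmentEnum_succ (j : ℤ) : (latticeGraph σ ϖ ((StdForm.antidiagonal 3).over K)).Adj (A j) (A (j + 1)) := by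
  have hϖ1 : Valued.v ϖ ≤ 1 := v_le_one_of_v_eq_exp_neg_one hd.vϖ
  have hϖ0 : ϖ ≠ 0 := uniformizer_ne_zero hd.vϖ
  obtain ⟨a, rfl | rfl⟩ := Int.even_or_odd' j
  · have e1 : A (2 * a) = ⟨latt (Matrix.diagonal ![ϖ ^ a, (1 : K), ϖ ^ (-a)]), ⟨0, isSelfDualLattice_latt_diagonal_zpow hd.σσ hd.σϖ hϖ1 hϖ0 a⟩⟩ :=
      Subtype.ext (hA0 a)
    have e2 : A (2 * a + 1) = ⟨latt (Matrix.diagonal ![ϖ ^ (a + 1), (1 : K), ϖ ^ (1 - (a + 1))]),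
        ⟨2, isVertexLattice_two_latt_diagonal_zpow hd.σσ hd.σϖ hϖ1 hϖ0 (a + 1)⟩⟩ :=
      Subtype.ext (by rw [hA1 a]; change _ = latt (Matrix.diagonal ![ϖ ^ (a + 1), (1 : K), ϖ ^ (1 - (a + 1))]); rw [show (1 - (a + 1) : ℤ) = -a by ring])
    rw [e1, e2]
    exact latticeGraph_adj_apartment_selfDual_two_succ hd.σσ hd.σϖ hd.vϖ a
  · have e1 : A (2 * a + 1) = ⟨latt (Matrix.diagonal ![ϖ ^ (a + 1), (1 : K), ϖ ^ (1 - (a + 1))]),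
        ⟨2, isVertexLattice_two_latt_diagonal_zpow hd.σσ hd.σϖ hϖ1 hϖ0 (a + 1)⟩⟩ :=
      Subtype.ext (by rw [hA1 a]; change _ = latt (Matrix.diagonal ![ϖ ^ (a + 1), (1 : K), ϖ ^ (1 - (a + 1))]); rw [show (1 - (a + 1) : ℤ) = -a by ring])
    have e2 : A (2 * a + 1 + 1) = ⟨latt (Matrix.diagonal ![ϖ ^ (a + 1), (1 : K), ϖ ^ (-(a + 1))]),
        ⟨0, isSelfDualLattice_latt_diagonal_zpow hd.σσ hd.σϖ hϖ1 hϖ0 (a + 1)⟩⟩ :=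
      Subtype.ext (by rw [show 2 * a + 1 + 1 = 2 * (a + 1) by ring, hA0 (a + 1)])
    rw [e1, e2]
    exact latticeGraph_adj_apartment_two_selfDual hd.σσ hd.σϖ hd.vϖ (a + 1)

omit hA0 hA1 in
/-- **Diagonal apartment lattices are determined by their exponents**: `latt diag(ϖ^p, 1, ϖ^q) = latt diag(ϖ^{p′}, 1, ϖ^{q′}) ↔ p = p′ ∧ q = q′` (★ entrywise comparison of
diagonal lattices + injectivity of `a ↦ |ϖ^a|`). [cite: Serre1980Trees, II.1.1] -/
theorem latt_diagonal_zpow_one_zpow_eq_iff (p q p' q' : ℤ) :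
    latt (Matrix.diagonal ![ϖ ^ p, (1 : K), ϖ ^ q]) = latt (Matrix.diagonal ![ϖ ^ p', (1 : K), ϖ ^ q']) ↔ p = p' ∧ q = q' := by
  have hϖ0 : ϖ ≠ 0 := uniformizer_ne_zero hd.vϖ
  have hne : ∀ (r s : ℤ) (i : Fin 3), (![ϖ ^ r, (1 : K), ϖ ^ s] : Fin 3 → K) i ≠ 0 := by
    intro r s i
    fin_cases i
    · exact zpow_ne_zero r hϖ0
    · exact one_ne_zero
    · exact zpow_ne_zero s hϖ0
  constructor
  · intro h
    have h1 := (latt_diagonal_le_latt_diagonal_iff (hne p q) (hne p' q')).1 h.le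
    have h2 := (latt_diagonal_le_latt_diagonal_iff (hne p' q') (hne p q)).1 h.ge
    have e0 : Valued.v (ϖ ^ p) ≤ Valued.v (ϖ ^ p') := h1 0
    have e0' : Valued.v (ϖ ^ p') ≤ Valued.v (ϖ ^ p) := h2 0
    have e2 : Valued.v (ϖ ^ q) ≤ Valued.v (ϖ ^ q') := h1 2
    have e2' : Valued.v (ϖ ^ q') ≤ Valued.v (ϖ ^ q) := h2 2
    rw [v_zpow_le_v_zpow_iff hd.vϖ] at e0 e0' e2 e2'
    exact ⟨le_antisymm e0' e0, le_antisymm e2' e2⟩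
  · rintro ⟨rfl, rfl⟩
    rfl

/-- **The enumeration is injective.** [cite: BruhatTits1972, §10] [cite: Serre1980Trees, II.1.1] -/
theorem apartmentEnum_injective : Function.Injective A := by
  intro j j' h
  have h' : (A j).1 = (A j').1 := by rw [h]
  obtain ⟨a, rfl | rfl⟩ := Int.even_or_odd' j <;> obtain ⟨b, rfl | rfl⟩ := Int.even_or_odd' j'
  · rw [hA0, hA0, latt_diagonal_zpow_one_zpow_eq_iff hd] at h'; omega
  · rw [hA0, hA1, latt_diagonal_zpow_one_zpow_eq_iff hd] at h'; omega
  · rw [hA1, hA0, latt_diagonal_zpow_one_zpow_eq_iff hd] at h'; omega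
  · rw [hA1, hA1, latt_diagonal_zpow_one_zpow_eq_iff hd] at h'; omega

/-- **`dist (A i) (A k) = |k − i|` in the tree** (the enumeration is an injective sequence of consecutive neighbours, ★ `SequencePath.dist_eq_natAbs`). [cite: Serre1980Trees, I.2.2 Prop. 8; II.1.1] -/
theorem dist_apartmentEnum (i k : ℤ) : (latticeGraph σ ϖ ((StdForm.antidiagonal 3).over K)).dist (A i) (A k) = (k - i).natAbs :=
  SequencePath.dist_eq_natAbs (isTree_latticeGraph_three_of_unramified hd) A (latticeGraph_adj_apartmentEnum_succ hd A hA0 hA1)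
    (apartmentEnum_injective hd A hA0 hA1) i k

/-- **Every vertex on the geodesic `[A i, A k]` (`i ≤ k`) is an `A j`, `i ≤ j ≤ k`.** [cite: Serre1980Trees, I.2.2 Prop. 8] [cite: BruhatTits1972, §10] -/
theorem exists_eq_apartmentEnum_of_dist_add_dist_eq {i k : ℤ} (hik : i ≤ k) {w : {M : Submodule 𝒪[K] (Fin 3 → K) // IsVertex σ ϖ ((StdForm.antidiagonal 3).over K) M}}
    (hw : (latticeGraph σ ϖ ((StdForm.antidiagonal 3).over K)).dist (A i) w + (latticeGraph σ ϖ ((StdForm.antidiagonal 3).over K)).dist w (A k) =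
      (latticeGraph σ ϖ ((StdForm.antidiagonal 3).over K)).dist (A i) (A k)) :
    ∃ j : ℤ, i ≤ j ∧ j ≤ k ∧ w = A j :=
  SequencePath.exists_eq_of_dist_add_dist_eq (isTree_latticeGraph_three_of_unramified hd) A (latticeGraph_adj_apartmentEnum_succ hd A hA0 hA1)
    (apartmentEnum_injective hd A hA0 hA1) hik hw

omit hd in
/-- **The long Weyl element reverses the apartment: `w₀ · A j = A (−j)`** (`w₀ · latt diag(f) = latt diag(f ∘ rev)`, ★ `mapGL_weylLongU_latt_diagonal_mul` + ★ `latt_mul_antidiagonal`).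
[cite: BruhatTits1972, §10] -/
theorem mapGL_weylLongU_apartmentEnum (j : ℤ) :
    mapGL (UnitaryGroup.weylLongU σ (rfl : (StdForm.antidiagonal 3).over K = (StdForm.antidiagonal 3).over K) : GL (Fin 3) K) (A j).1 = (A (-j)).1 := by
  have key : ∀ f : Fin 3 → K, mapGL (UnitaryGroup.weylLongU σ (rfl : (StdForm.antidiagonal 3).over K = (StdForm.antidiagonal 3).over K) : GL (Fin 3) K)
      (latt (Matrix.diagonal f)) = latt (Matrix.diagonal ![f 2, f 1, f 0]) := by
    intro f
    have h := mapGL_weylLongU_latt_diagonal_mul (σ := σ) f 1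
    rw [Matrix.mul_one, Matrix.mul_one, latt_mul_antidiagonal] at h
    rw [h]
    congr 2
    funext i
    fin_cases i <;> rfl
  obtain ⟨a, rfl | rfl⟩ := Int.even_or_odd' j
  · rw [hA0, key, show -(2 * a) = 2 * (-a) by ring, hA0, neg_neg]
    rfl
  · rw [hA1, key, show -(2 * a + 1) = 2 * (-a - 1) + 1 by ring, hA1, show -a - 1 + 1 = -a by ring, show -(-a - 1) = a + 1 by ring]
    rfl

omit hd hA1 in
/-- **`A 0 = 𝒪³`** (the root `L₀`). [cite: Serre1980Trees, II.1.1] -/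
theorem coe_apartmentEnum_zero : (A 0).1 = stdLattice K 3 := by
  rw [show (0 : ℤ) = 2 * 0 by ring, hA0, zpow_zero, neg_zero, zpow_zero, ← latt_one]
  congr 1
  rw [← Matrix.diagonal_one]
  congr 1
  funext i
  fin_cases i <;> rfl

/-! ### Transport of the enumeration by `u ∈ U(σ, J₀)` -/

/-- The translated enumeration `j ↦ u · A j` is again an injective sequence of consecutive neighbours, so **`dist (u·A i) (u·A k) = |k − i|`**. [cite: BruhatTits1972, §10]
[cite: Serre1980Trees, I.2.2 Prop. 8] -/
theorem dist_latticeGraphIso_apartmentEnum (u : unitaryGroupOfForm σ ((StdForm.antidiagonal 3).over K)) (i k : ℤ) :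
    (latticeGraph σ ϖ ((StdForm.antidiagonal 3).over K)).dist (latticeGraphIso σ ϖ ((StdForm.antidiagonal 3).over K) u (A i))
      (latticeGraphIso σ ϖ ((StdForm.antidiagonal 3).over K) u (A k)) = (k - i).natAbs := by
  rw [TreeLayers.dist_iso_apply, dist_apartmentEnum hd A hA0 hA1]

/-- **Every vertex on the geodesic `[u·A i, u·A k]` (`i ≤ k`) is `u·A j` with `i ≤ j ≤ k`.** [cite: BruhatTits1972, §10] [cite: Serre1980Trees, I.2.2 Prop. 8] -/
theorem exists_eq_latticeGraphIso_apartmentEnum_of_dist_add_dist_eq (u : unitaryGroupOfForm σ ((StdForm.antidiagonal 3).over K)) {i k : ℤ} (hik : i ≤ k)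
    {w : {M : Submodule 𝒪[K] (Fin 3 → K) // IsVertex σ ϖ ((StdForm.antidiagonal 3).over K) M}}
    (hw : (latticeGraph σ ϖ ((StdForm.antidiagonal 3).over K)).dist (latticeGraphIso σ ϖ ((StdForm.antidiagonal 3).over K) u (A i)) w +
        (latticeGraph σ ϖ ((StdForm.antidiagonal 3).over K)).dist w (latticeGraphIso σ ϖ ((StdForm.antidiagonal 3).over K) u (A k)) =
      (latticeGraph σ ϖ ((StdForm.antidiagonal 3).over K)).dist (latticeGraphIso σ ϖ ((StdForm.antidiagonal 3).over K) u (A i))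
        (latticeGraphIso σ ϖ ((StdForm.antidiagonal 3).over K) u (A k))) :
    ∃ j : ℤ, i ≤ j ∧ j ≤ k ∧ w = latticeGraphIso σ ϖ ((StdForm.antidiagonal 3).over K) u (A j) :=
  SequencePath.exists_eq_of_dist_add_dist_eq (isTree_latticeGraph_three_of_unramified hd) (fun j => latticeGraphIso σ ϖ ((StdForm.antidiagonal 3).over K) u (A j))
    (fun j => ((latticeGraphIso σ ϖ ((StdForm.antidiagonal 3).over K) u).map_adj_iff).2 (latticeGraph_adj_apartmentEnum_succ hd A hA0 hA1 j))
    ((latticeGraphIso σ ϖ ((StdForm.antidiagonal 3).over K) u).injective.comp (apartmentEnum_injective hd A hA0 hA1)) hik hw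

/-! ## §2 Two vertices lie in one translate of the standard apartment -/

/-- **TWO SELF-DUAL VERTICES LIE IN ONE APARTMENT TRANSLATE**: `x = u·A 0 = u·L₀` and `z = u·A (2b) = u·L_b` for some `u ∈ U(σ, J₀)` and `b ≥ 0` (★ frames
`x = k·t_a·L₀`, `g⁻¹z = k′·L_b` with `k, k′ ∈ K₀` fixing `L₀`, and ★ `w₀` reverses the sign of `b`). [cite: BruhatTits1972, (7.4.18), §10] [cite: Serre1980Trees, II.1.1] -/
theorem exists_latticeGraphIso_apartmentEnum_of_isSelfDualLattice₂ {x z : {M : Submodule 𝒪[K] (Fin 3 → K) // IsVertex σ ϖ ((StdForm.antidiagonal 3).over K) M}}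
    (hx : IsSelfDualLattice σ ϖ ((StdForm.antidiagonal 3).over K) x.1) (hz : IsSelfDualLattice σ ϖ ((StdForm.antidiagonal 3).over K) z.1) :
    ∃ u : unitaryGroupOfForm σ ((StdForm.antidiagonal 3).over K), ∃ b : ℤ, 0 ≤ b ∧
      x = latticeGraphIso σ ϖ ((StdForm.antidiagonal 3).over K) u (A 0) ∧ z = latticeGraphIso σ ϖ ((StdForm.antidiagonal 3).over K) u (A (2 * b)) := by
  have hϖ0 : ϖ ≠ 0 := uniformizer_ne_zero hd.vϖ
  -- `x = k · t_a · L₀`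
  obtain ⟨k, hk, a, hxa⟩ := exists_frame_three_of_isSelfDualLattice hd hx
  obtain ⟨t, ht⟩ := exists_coe_eq_diagonal_zpow hd.σσ hd.σϖ hϖ0 a
  have hA0' : (A 0).1 = stdLattice K 3 := coe_apartmentEnum_zero A hA0
  have htL : mapGL (t : GL (Fin 3) K) (A 0).1 = latt (Matrix.diagonal ![ϖ ^ a, (1 : K), ϖ ^ (-a)]) := by
    rw [hA0', ← latt_one, mapGL_coe_latt_eq t ht, Matrix.mul_one]
  have hxg : x.1 = mapGL ((k * t : unitaryGroupOfForm σ ((StdForm.antidiagonal 3).over K)) : GL (Fin 3) K) (A 0).1 := by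
    rw [Subgroup.coe_mul, mapGL_mul, htL, hxa]
  -- `g⁻¹ z` is self-dual, hence `= k′ · L_b`
  set g : unitaryGroupOfForm σ ((StdForm.antidiagonal 3).over K) := k * t with hg
  have hz' : IsSelfDualLattice σ ϖ ((StdForm.antidiagonal 3).over K) (mapGL ((g⁻¹ : unitaryGroupOfForm σ ((StdForm.antidiagonal 3).over K)) : GL (Fin 3) K) z.1) :=
    (isVertexLattice_mapGL_iff σ ϖ ((StdForm.antidiagonal 3).over K) g⁻¹ z.1).2 hz
  obtain ⟨k', hk', b, hzb⟩ := exists_frame_three_of_isSelfDualLattice hd hz'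
  have hz1 : z.1 = mapGL ((g * k' : unitaryGroupOfForm σ ((StdForm.antidiagonal 3).over K)) : GL (Fin 3) K) (A (2 * b)).1 := by
    rw [hA0, Subgroup.coe_mul, mapGL_mul, ← hzb, ← mapGL_mul, Subgroup.coe_inv, mul_inv_cancel, mapGL_one]
  have hx1 : x.1 = mapGL ((g * k' : unitaryGroupOfForm σ ((StdForm.antidiagonal 3).over K)) : GL (Fin 3) K) (A 0).1 := by
    rw [Subgroup.coe_mul, mapGL_mul, hA0', mapGL_stdLattice_of_mem_unitaryInt hk', ← hA0', ← hxg]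
  rcases le_or_gt 0 b with hb | hb
  · exact ⟨g * k', b, hb, Subtype.ext hx1, Subtype.ext hz1⟩
  · -- reverse the apartment with `w₀ ∈ K₀`
    refine ⟨g * k' * UnitaryGroup.weylLongU σ rfl, -b, by omega, Subtype.ext ?_, Subtype.ext ?_⟩
    · change x.1 = mapGL _ (A 0).1
      rw [Subgroup.coe_mul, mapGL_mul, hA0', mapGL_stdLattice_of_mem_unitaryInt (weylLongU_mem_unitaryInt hd.vσ), ← hA0', hx1]
    · change z.1 = mapGL _ (A (2 * -b)).1
      rw [Subgroup.coe_mul, mapGL_mul, mapGL_weylLongU_apartmentEnum A hA0 hA1, show -(2 * -b) = 2 * b by ring, hz1]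

omit hA0 in
/-- **A TYPE-TWO VERTEX IS `v · A (−1) = v · N₁`** for some `v ∈ U(σ, J₀)` (★ type-two transitivity), so its two apartment neighbours `v·A 0`, `v·A (−2)` are self-dual
neighbours of it. [cite: BruhatTits1972, §10] -/
theorem exists_eq_latticeGraphIso_apartmentEnum_neg_one {z : {M : Submodule 𝒪[K] (Fin 3 → K) // IsVertex σ ϖ ((StdForm.antidiagonal 3).over K) M}}
    (hz : IsVertexLattice σ ϖ ((StdForm.antidiagonal 3).over K) 2 z.1) :
    ∃ v : unitaryGroupOfForm σ ((StdForm.antidiagonal 3).over K), z = latticeGraphIso σ ϖ ((StdForm.antidiagonal 3).over K) v (A (-1)) := by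
  obtain ⟨v, hv⟩ := forall_isVertexLattice_two_exists_mapGL_N₁_eq hd z.1 hz
  refine ⟨v, Subtype.ext ?_⟩
  change z.1 = mapGL _ (A (-1)).1
  rw [hv, show (-1 : ℤ) = 2 * (-1) + 1 by ring, hA1, show (-1 + 1 : ℤ) = 0 by ring, zpow_zero, neg_neg, zpow_one]

/-- **A SELF-DUAL VERTEX AND ANY VERTEX LIE IN ONE APARTMENT TRANSLATE**: `x = u·A 0`, `z = u·A k`, `0 ≤ k` (a type-two `z` is pushed to an outward self-dual neighbour
`c` (★ `SequencePath.exists_dist_eq_succ_of_adj_of_adj`), the self-dual pair `(x, c)` is placed, and `z ∈ [x, c]` is read off the apartment). [cite: BruhatTits1972, (7.4.18), §10] [cite: Serre1980Trees, I.2.2, II.1.1] -/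
theorem exists_latticeGraphIso_apartmentEnum_of_isSelfDualLattice {x : {M : Submodule 𝒪[K] (Fin 3 → K) // IsVertex σ ϖ ((StdForm.antidiagonal 3).over K) M}}
    (hx : IsSelfDualLattice σ ϖ ((StdForm.antidiagonal 3).over K) x.1) (z : {M : Submodule 𝒪[K] (Fin 3 → K) // IsVertex σ ϖ ((StdForm.antidiagonal 3).over K) M}) :
    ∃ u : unitaryGroupOfForm σ ((StdForm.antidiagonal 3).over K), ∃ k : ℤ, 0 ≤ k ∧
      x = latticeGraphIso σ ϖ ((StdForm.antidiagonal 3).over K) u (A 0) ∧ z = latticeGraphIso σ ϖ ((StdForm.antidiagonal 3).over K) u (A k) := by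
  have hT := isTree_latticeGraph_three_of_unramified hd
  obtain ⟨d, hzd⟩ := z.2
  rcases type_eq_zero_or_two_of_isVertexLattice_three hd.vσ hd.vϖ v_det_antidiagonal_three hzd with rfl | rfl
  · obtain ⟨u, b, hb, hxu, hzu⟩ := exists_latticeGraphIso_apartmentEnum_of_isSelfDualLattice₂ hd A hA0 hA1 hx hzd
    exact ⟨u, 2 * b, by omega, hxu, hzu⟩
  · -- `z = v · A (−1)` with self-dual neighbours `v · A 0`, `v · A (−2)`
    obtain ⟨v, hzv⟩ := exists_eq_latticeGraphIso_apartmentEnum_neg_one hd A hA1 hzd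
    have hadj : ∀ j : ℤ, (latticeGraph σ ϖ ((StdForm.antidiagonal 3).over K)).Adj (latticeGraphIso σ ϖ ((StdForm.antidiagonal 3).over K) v (A j))
        (latticeGraphIso σ ϖ ((StdForm.antidiagonal 3).over K) v (A (j + 1))) :=
      fun j => ((latticeGraphIso σ ϖ ((StdForm.antidiagonal 3).over K) v).map_adj_iff).2 (latticeGraph_adj_apartmentEnum_succ hd A hA0 hA1 j)
    have h₀ : (latticeGraph σ ϖ ((StdForm.antidiagonal 3).over K)).Adj z (latticeGraphIso σ ϖ ((StdForm.antidiagonal 3).over K) v (A 0)) := by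
      rw [hzv]; have := hadj (-1); rwa [show (-1 + 1 : ℤ) = 0 by ring] at this
    have h₁ : (latticeGraph σ ϖ ((StdForm.antidiagonal 3).over K)).Adj z (latticeGraphIso σ ϖ ((StdForm.antidiagonal 3).over K) v (A (-2))) := by
      rw [hzv]; have := hadj (-2); rw [show (-2 + 1 : ℤ) = -1 by ring] at this; exact this.symm
    have hne : latticeGraphIso σ ϖ ((StdForm.antidiagonal 3).over K) v (A 0) ≠ latticeGraphIso σ ϖ ((StdForm.antidiagonal 3).over K) v (A (-2)) := by
      intro h
      have := apartmentEnum_injective hd A hA0 hA1 ((latticeGraphIso σ ϖ ((StdForm.antidiagonal 3).over K) v).injective h)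
      omega
    -- self-duality of the two neighbours
    have hsd : ∀ b : ℤ, IsSelfDualLattice σ ϖ ((StdForm.antidiagonal 3).over K) (latticeGraphIso σ ϖ ((StdForm.antidiagonal 3).over K) v (A (2 * b))).1 := by
      intro b
      change IsVertexLattice σ ϖ ((StdForm.antidiagonal 3).over K) 0 (mapGL _ (A (2 * b)).1)
      rw [isVertexLattice_mapGL_iff, hA0]
      exact isSelfDualLattice_latt_diagonal_zpow hd.σσ hd.σϖ (v_le_one_of_v_eq_exp_neg_one hd.vϖ) (uniformizer_ne_zero hd.vϖ) b
    -- the outward neighbour `c` and the placement of `(x, c)`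
    have key : ∀ c : {M : Submodule 𝒪[K] (Fin 3 → K) // IsVertex σ ϖ ((StdForm.antidiagonal 3).over K) M},
        IsSelfDualLattice σ ϖ ((StdForm.antidiagonal 3).over K) c.1 → (latticeGraph σ ϖ ((StdForm.antidiagonal 3).over K)).Adj z c →
        (latticeGraph σ ϖ ((StdForm.antidiagonal 3).over K)).dist x c = (latticeGraph σ ϖ ((StdForm.antidiagonal 3).over K)).dist x z + 1 →
        ∃ u : unitaryGroupOfForm σ ((StdForm.antidiagonal 3).over K), ∃ k : ℤ, 0 ≤ k ∧
          x = latticeGraphIso σ ϖ ((StdForm.antidiagonal 3).over K) u (A 0) ∧ z = latticeGraphIso σ ϖ ((StdForm.antidiagonal 3).over K) u (A k) := by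
      intro c hc hzc hdc
      obtain ⟨u, b, hb, hxu, hcu⟩ := exists_latticeGraphIso_apartmentEnum_of_isSelfDualLattice₂ hd A hA0 hA1 hx hc
      have hzc1 : (latticeGraph σ ϖ ((StdForm.antidiagonal 3).over K)).dist z c = 1 := SimpleGraph.dist_eq_one_iff_adj.2 hzc
      have hbetween : (latticeGraph σ ϖ ((StdForm.antidiagonal 3).over K)).dist x z + (latticeGraph σ ϖ ((StdForm.antidiagonal 3).over K)).dist z c =
          (latticeGraph σ ϖ ((StdForm.antidiagonal 3).over K)).dist x c := by rw [hzc1, hdc]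
      rw [hxu, hcu] at hbetween
      obtain ⟨j, hj0, -, hzj⟩ := exists_eq_latticeGraphIso_apartmentEnum_of_dist_add_dist_eq hd A hA0 hA1 u (by omega : (0 : ℤ) ≤ 2 * b) hbetween
      exact ⟨u, j, hj0, hxu, hzj⟩
    rcases SequencePath.exists_dist_eq_succ_of_adj_of_adj hT x h₀ h₁ hne with h | h
    · exact key _ (by simpa using hsd 0) h₀ h
    · exact key _ (by simpa using hsd (-1)) h₁ h

/-- **ANY TWO VERTICES OF THE UNRAMIFIED `U(3)` TREE LIE IN ONE TRANSLATE OF THE STANDARD APARTMENT**: `x = u·A i`, `z = u·A k` with `u ∈ U(σ, J₀)` and `i ≤ k`.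
[cite: BruhatTits1972, (7.4.18), §10] [cite: Serre1980Trees, I.2.2, II.1.1] -/
theorem exists_latticeGraphIso_apartmentEnum_pair (x z : {M : Submodule 𝒪[K] (Fin 3 → K) // IsVertex σ ϖ ((StdForm.antidiagonal 3).over K) M}) :
    ∃ u : unitaryGroupOfForm σ ((StdForm.antidiagonal 3).over K), ∃ i k : ℤ, i ≤ k ∧
      x = latticeGraphIso σ ϖ ((StdForm.antidiagonal 3).over K) u (A i) ∧ z = latticeGraphIso σ ϖ ((StdForm.antidiagonal 3).over K) u (A k) := by
  have hT := isTree_latticeGraph_three_of_unramified hd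
  obtain ⟨d, hxd⟩ := x.2
  rcases type_eq_zero_or_two_of_isVertexLattice_three hd.vσ hd.vϖ v_det_antidiagonal_three hxd with rfl | rfl
  · obtain ⟨u, k, hk, hxu, hzu⟩ := exists_latticeGraphIso_apartmentEnum_of_isSelfDualLattice hd A hA0 hA1 hxd z
    exact ⟨u, 0, k, hk, hxu, hzu⟩
  · -- push the type-two `x` to an outward self-dual neighbour `c` (away from `z`), place `(c, z)`, and read `x ∈ [c, z]` off the apartment
    obtain ⟨v, hxv⟩ := exists_eq_latticeGraphIso_apartmentEnum_neg_one hd A hA1 hxd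
    have hadj : ∀ j : ℤ, (latticeGraph σ ϖ ((StdForm.antidiagonal 3).over K)).Adj (latticeGraphIso σ ϖ ((StdForm.antidiagonal 3).over K) v (A j))
        (latticeGraphIso σ ϖ ((StdForm.antidiagonal 3).over K) v (A (j + 1))) :=
      fun j => ((latticeGraphIso σ ϖ ((StdForm.antidiagonal 3).over K) v).map_adj_iff).2 (latticeGraph_adj_apartmentEnum_succ hd A hA0 hA1 j)
    have h₀ : (latticeGraph σ ϖ ((StdForm.antidiagonal 3).over K)).Adj x (latticeGraphIso σ ϖ ((StdForm.antidiagonal 3).over K) v (A 0)) := by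
      rw [hxv]; have := hadj (-1); rwa [show (-1 + 1 : ℤ) = 0 by ring] at this
    have h₁ : (latticeGraph σ ϖ ((StdForm.antidiagonal 3).over K)).Adj x (latticeGraphIso σ ϖ ((StdForm.antidiagonal 3).over K) v (A (-2))) := by
      rw [hxv]; have := hadj (-2); rw [show (-2 + 1 : ℤ) = -1 by ring] at this; exact this.symm
    have hne : latticeGraphIso σ ϖ ((StdForm.antidiagonal 3).over K) v (A 0) ≠ latticeGraphIso σ ϖ ((StdForm.antidiagonal 3).over K) v (A (-2)) := by
      intro h
      have := apartmentEnum_injective hd A hA0 hA1 ((latticeGraphIso σ ϖ ((StdForm.antidiagonal 3).over K) v).injective h)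
      omega
    have hsd : ∀ b : ℤ, IsSelfDualLattice σ ϖ ((StdForm.antidiagonal 3).over K) (latticeGraphIso σ ϖ ((StdForm.antidiagonal 3).over K) v (A (2 * b))).1 := by
      intro b
      change IsVertexLattice σ ϖ ((StdForm.antidiagonal 3).over K) 0 (mapGL _ (A (2 * b)).1)
      rw [isVertexLattice_mapGL_iff, hA0]
      exact isSelfDualLattice_latt_diagonal_zpow hd.σσ hd.σϖ (v_le_one_of_v_eq_exp_neg_one hd.vϖ) (uniformizer_ne_zero hd.vϖ) b
    have key : ∀ c : {M : Submodule 𝒪[K] (Fin 3 → K) // IsVertex σ ϖ ((StdForm.antidiagonal 3).over K) M},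
        IsSelfDualLattice σ ϖ ((StdForm.antidiagonal 3).over K) c.1 → (latticeGraph σ ϖ ((StdForm.antidiagonal 3).over K)).Adj x c →
        (latticeGraph σ ϖ ((StdForm.antidiagonal 3).over K)).dist z c = (latticeGraph σ ϖ ((StdForm.antidiagonal 3).over K)).dist z x + 1 →
        ∃ u : unitaryGroupOfForm σ ((StdForm.antidiagonal 3).over K), ∃ i k : ℤ, i ≤ k ∧
          x = latticeGraphIso σ ϖ ((StdForm.antidiagonal 3).over K) u (A i) ∧ z = latticeGraphIso σ ϖ ((StdForm.antidiagonal 3).over K) u (A k) := by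
      intro c hc hxc hdc
      obtain ⟨u, k, hk, hcu, hzu⟩ := exists_latticeGraphIso_apartmentEnum_of_isSelfDualLattice hd A hA0 hA1 hc z
      have hcx1 : (latticeGraph σ ϖ ((StdForm.antidiagonal 3).over K)).dist c x = 1 := SimpleGraph.dist_eq_one_iff_adj.2 hxc.symm
      have hbetween : (latticeGraph σ ϖ ((StdForm.antidiagonal 3).over K)).dist c x + (latticeGraph σ ϖ ((StdForm.antidiagonal 3).over K)).dist x z =
          (latticeGraph σ ϖ ((StdForm.antidiagonal 3).over K)).dist c z := by
        rw [hcx1, SimpleGraph.dist_comm (u := c) (v := z), hdc, SimpleGraph.dist_comm (u := z) (v := x), add_comm]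
      rw [hcu, hzu] at hbetween
      obtain ⟨j, hj0, hjk, hxj⟩ := exists_eq_latticeGraphIso_apartmentEnum_of_dist_add_dist_eq hd A hA0 hA1 u hk hbetween
      exact ⟨u, j, k, hjk, hxj, hzu⟩
    rcases SequencePath.exists_dist_eq_succ_of_adj_of_adj hT z h₀ h₁ hne with h | h
    · exact key _ (by simpa using hsd 0) h₀ h
    · exact key _ (by simpa using hsd (-1)) h₁ h

/-- **THE GEODESIC BETWEEN TWO VERTICES LIES IN ONE APARTMENT TRANSLATE**: with `x = u·A i`, `z = u·A k`, `i ≤ k` as above, `dist x z = k − i` and every `w` with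
`dist x w + dist w z = dist x z` is `u·A j` for some `i ≤ j ≤ k`. [cite: BruhatTits1972, (7.4.18), §10] [cite: Serre1980Trees, I.2.2 Prop. 8] -/
theorem exists_latticeGraphIso_apartmentEnum_geodesic (x z : {M : Submodule 𝒪[K] (Fin 3 → K) // IsVertex σ ϖ ((StdForm.antidiagonal 3).over K) M}) :
    ∃ u : unitaryGroupOfForm σ ((StdForm.antidiagonal 3).over K), ∃ i k : ℤ, i ≤ k ∧
      x = latticeGraphIso σ ϖ ((StdForm.antidiagonal 3).over K) u (A i) ∧ z = latticeGraphIso σ ϖ ((StdForm.antidiagonal 3).over K) u (A k) ∧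
      ((latticeGraph σ ϖ ((StdForm.antidiagonal 3).over K)).dist x z : ℤ) = k - i ∧
      ∀ w, (latticeGraph σ ϖ ((StdForm.antidiagonal 3).over K)).dist x w + (latticeGraph σ ϖ ((StdForm.antidiagonal 3).over K)).dist w z =
          (latticeGraph σ ϖ ((StdForm.antidiagonal 3).over K)).dist x z →
        ∃ j : ℤ, i ≤ j ∧ j ≤ k ∧ w = latticeGraphIso σ ϖ ((StdForm.antidiagonal 3).over K) u (A j) := by
  obtain ⟨u, i, k, hik, hxu, hzu⟩ := exists_latticeGraphIso_apartmentEnum_pair hd A hA0 hA1 x z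
  refine ⟨u, i, k, hik, hxu, hzu, ?_, fun w hw => ?_⟩
  · rw [hxu, hzu, dist_latticeGraphIso_apartmentEnum hd A hA0 hA1]; omega
  · rw [hxu, hzu] at hw
    exact exists_eq_latticeGraphIso_apartmentEnum_of_dist_add_dist_eq hd A hA0 hA1 u hik hw

/-- **THE (U7) CONSUMER SHAPE** (★ row 34 `hU7`'s antecedent): for `x ~ y` with `y` the first step of the geodesic `[x, z]` (`dist y z + 1 = dist x z`) there are `u ∈ U(σ, J₀)`
and `i + 1 ≤ k` with `(x, y, z) = u·(A i, A (i+1), A k)`. [cite: SchneiderStuhler1997, Prop. I.3.1 p. 118] [cite: BruhatTits1972, (7.4.18), §10] -/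
theorem exists_latticeGraphIso_apartmentEnum_of_adj_of_dist {x y z : {M : Submodule 𝒪[K] (Fin 3 → K) // IsVertex σ ϖ ((StdForm.antidiagonal 3).over K) M}}
    (hxy : (latticeGraph σ ϖ ((StdForm.antidiagonal 3).over K)).Adj x y)
    (hyz : (latticeGraph σ ϖ ((StdForm.antidiagonal 3).over K)).dist y z + 1 = (latticeGraph σ ϖ ((StdForm.antidiagonal 3).over K)).dist x z) :
    ∃ u : unitaryGroupOfForm σ ((StdForm.antidiagonal 3).over K), ∃ i k : ℤ, i + 1 ≤ k ∧
      x = latticeGraphIso σ ϖ ((StdForm.antidiagonal 3).over K) u (A i) ∧ y = latticeGraphIso σ ϖ ((StdForm.antidiagonal 3).over K) u (A (i + 1)) ∧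
      z = latticeGraphIso σ ϖ ((StdForm.antidiagonal 3).over K) u (A k) := by
  obtain ⟨u, i, k, hik, hxu, hzu, -, hgeo⟩ := exists_latticeGraphIso_apartmentEnum_geodesic hd A hA0 hA1 x z
  have hxy1 : (latticeGraph σ ϖ ((StdForm.antidiagonal 3).over K)).dist x y = 1 := SimpleGraph.dist_eq_one_iff_adj.2 hxy
  obtain ⟨j, hij, hjk, hyj⟩ := hgeo y (by rw [hxy1, ← hyz, add_comm])
  have hj : j = i + 1 := by
    have h1 : (latticeGraph σ ϖ ((StdForm.antidiagonal 3).over K)).dist x y = (j - i).natAbs := by rw [hxu, hyj, dist_latticeGraphIso_apartmentEnum hd A hA0 hA1]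
    rw [hxy1] at h1
    omega
  subst hj
  exact ⟨u, i, k, hjk, hxu, hyj, hzu⟩

end Enum

end Literature.NumberTheory.Automorphic.UnitaryLatticeTree
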